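import Summits.CriticalPhenomena.CardyFormulaZ2.Theses.CardyTensorRG
import Summits.CriticalPhenomena.CardyFormulaZ2.Theorems.CardyTensorRGPolyominoGaussianLawMeshEquicontinuity
import Summits.CriticalPhenomena.CardyFormulaZ2.Theorems.CardyTensorRGPolyominoGaussianLawStubPolyominoRefinement

/-!
# Reduction of the crux `PolyominoGaussianLaw` to its dyadic cores
# (stmt-CriticalPhenomena-14337, route `CardyTensorRG`, line `registered`, skeleton v4/v5)

The crux `CardyTensorRG.PolyominoGaussianLaw` — ONE exponent `a ∈ (0,1)` such that every polyomino
conformal rectangle with lattice marks has bond-`ℤ²` crossing limit `I_a(cross-ratio)` as the mesh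
`δ → 0⁺` — FOLLOWS from its two pure-dyadic cores, the registered open stubs of the line:

* dyadic LimitExists: for every polyomino representation `(δ₀, s)` with lattice marks of `R`, the
  crossing probabilities along the `2×2`-blocking orbit `δ₀ · 2^(−k)` converge;
* dyadic identification: one `a ∈ (0,1)` such that every such dyadic orbit limit equals `I_a(η)`.

Everything else is a theorem of the tree: refinement of representations
(`stub_polyominoRefinement`: the orbit `δ₀/(q·2^k)` is the dyadic orbit of the refined representation at
spacing `δ₀/q`), mesh equicontinuity of polyomino crossing probabilities (`stub_meshEquicontinuity`:
exact scale covariance of the discretisation + Schramm–Smirnov continuity (5.1) for bond-`ℤ²`), and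
the log-scale net lemma `tendsto_nhdsWithin_zero_of_orbits` below (pure real analysis: the orbit
meshes `δ₀/(q·2^k)`, `2^j ≤ q ≤ 2^(j+1)`, form a `(1 + 2^(−j))`-net of `(0, δ₀]` in logarithmic scale).

This file is the sorry-free assembly of the line's skeleton with the two open stubs as hypotheses
(registered reduction stub `stub_reductionToDyadic`); the two cores are the existence and the
conformal-invariance/identification halves of Cardy's formula on `ℤ²` restricted to dyadic orbits of
polyominoes — what the route's tensor-RG chain (GaussianSaddleCertificate stmt-13817 +
BoundaryTwistTensors stmt-7100 + RGToPolyominoLaw stmt-14645) is to deliver.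
-/

open Filter Topology Set

namespace Summit.CriticalPhenomena.CardyFormulaZ2.Cruxes.PolyominoGaussianLaw.Birth

/-- Pure real analysis: limits along all blocking orbits `δ₀/(q·2^k)` (`q ≥ 1`) to a common value `L`
plus vanishing oscillation over mesh windows `[δ, ρδ]` near `0` give the one-sided limit `δ → 0⁺`. [folklore] -/
theorem tendsto_nhdsWithin_zero_of_orbits {P : ℝ → ℝ} {δ₀ L : ℝ} (hδ₀ : 0 < δ₀)
    (horbit : ∀ q : ℕ, 1 ≤ q →
      Tendsto (fun k : ℕ => P (δ₀ / ((q : ℝ) * 2 ^ k))) atTop (𝓝 L))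
    (hcont : ∀ ε : ℝ, 0 < ε → ∃ ρ : ℝ, 1 < ρ ∧ ∃ δ₁ : ℝ, 0 < δ₁ ∧ ∀ δ δ' : ℝ, 0 < δ → δ ≤ δ' →
      δ' ≤ ρ * δ → δ' < δ₁ → |P δ' - P δ| ≤ ε) :
    Tendsto P (𝓝[>] 0) (𝓝 L) := by
  rw [Metric.tendsto_nhdsWithin_nhds]
  intro ε hε
  obtain ⟨ρ, hρ, δ₁, hδ₁, hC⟩ := hcont (ε / 2) (half_pos hε)
  -- (1) a dyadic scale `2^j` finer than the equicontinuity ratio: `1/2^j < ρ - 1`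
  obtain ⟨j, hj⟩ : ∃ j : ℕ, 1 / (ρ - 1) < (2 : ℝ) ^ j := by
    obtain ⟨N, hN⟩ := exists_nat_gt (1 / (ρ - 1))
    refine ⟨N, hN.trans_le ?_⟩
    exact_mod_cast (Nat.lt_two_pow_self).le
  have hρ1 : 0 < ρ - 1 := sub_pos.2 hρ
  have hj' : 1 / (2 : ℝ) ^ j < ρ - 1 := (one_div_lt hρ1 (by positivity)).1 hj
  -- (2) a uniform tail index over the finitely many orbits `2^j ≤ q ≤ 2^(j+1)`
  have hK : ∀ q : ℕ, ∃ Kq : ℕ, 1 ≤ q → ∀ k : ℕ, Kq ≤ k →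
      |P (δ₀ / ((q : ℝ) * 2 ^ k)) - L| < ε / 2 := by
    intro q
    by_cases hq : 1 ≤ q
    · have h := (Metric.tendsto_atTop.1 (horbit q hq)) (ε / 2) (half_pos hε)
      obtain ⟨N, hN⟩ := h
      refine ⟨N, fun _ k hk => ?_⟩
      have := hN k hk
      rwa [Real.dist_eq] at this
    · exact ⟨0, fun h => absurd h hq⟩
  choose K hK using hK
  set Kmax : ℕ := (Finset.range (2 ^ (j + 1) + 1)).sup K with hKmax_def
  have hKle : ∀ q : ℕ, q ≤ 2 ^ (j + 1) → K q ≤ Kmax := fun q hq =>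
    Finset.le_sup (f := K) (Finset.mem_range.2 (Nat.lt_succ_of_le hq))
  -- (3) the threshold
  refine ⟨min δ₁ (δ₀ / (2 : ℝ) ^ (j + Kmax + 2)), lt_min hδ₁ (by positivity), ?_⟩
  intro δ hδpos hδdist
  have hδ : 0 < δ := hδpos
  have hδlt : δ < min δ₁ (δ₀ / (2 : ℝ) ^ (j + Kmax + 2)) := by
    rwa [Real.dist_eq, sub_zero, abs_of_pos hδ] at hδdist
  have hδ₁' : δ < δ₁ := hδlt.trans_le (min_le_left _ _)
  have hδsmall : δ < δ₀ / (2 : ℝ) ^ (j + Kmax + 2) := hδlt.trans_le (min_le_right _ _)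
  -- u := δ₀ / δ, the inverse mesh in units of the base mesh
  set u : ℝ := δ₀ / δ with hu_def
  have hu_pos : 0 < u := div_pos hδ₀ hδ
  have hu_big : (2 : ℝ) ^ (j + Kmax + 2) < u := by
    rw [hu_def, lt_div_iff₀ hδ]
    have := (lt_div_iff₀ (by positivity : (0 : ℝ) < 2 ^ (j + Kmax + 2))).1 hδsmall
    linarith [this]
  -- (4) locate u dyadically: 2^n ≤ u / 2^j < 2^(n+1)
  have h2j : (0 : ℝ) < 2 ^ j := by positivity
  have hv1 : (1 : ℝ) ≤ u / 2 ^ j := by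
    rw [le_div_iff₀ h2j, one_mul]
    have h1 : (2 : ℝ) ^ j ≤ 2 ^ (j + Kmax + 2) := pow_le_pow_right₀ (by norm_num) (by omega)
    linarith
  obtain ⟨n, hn1, hn2⟩ := exists_nat_pow_near hv1 (one_lt_two)
  -- n is beyond the uniform tail index
  have hKn : Kmax ≤ n := by
    by_contra hcon
    have hcon : n < Kmax := not_le.1 hcon
    have h1 : u / 2 ^ j < (2 : ℝ) ^ (n + 1) := hn2
    have h2 : u < 2 ^ (n + 1) * 2 ^ j := by rwa [div_lt_iff₀ h2j] at h1
    have h3 : (2 : ℝ) ^ (n + 1) * 2 ^ j = 2 ^ (n + 1 + j) := by rw [← pow_add]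
    have h4 : (2 : ℝ) ^ (n + 1 + j) ≤ 2 ^ (j + Kmax + 2) := pow_le_pow_right₀ (by norm_num) (by omega)
    linarith
  -- w := u / 2^n ∈ [2^j, 2^(j+1)), q := ⌈w⌉₊
  have h2n : (0 : ℝ) < 2 ^ n := by positivity
  set w : ℝ := u / 2 ^ n with hw_def
  have hw_lo : (2 : ℝ) ^ j ≤ w := by
    rw [hw_def, le_div_iff₀ h2n]
    have := (le_div_iff₀ h2j).1 hn1
    linarith [this]
  have hw_hi : w < (2 : ℝ) ^ (j + 1) := by
    rw [hw_def, div_lt_iff₀ h2n]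
    have := (div_lt_iff₀ h2j).1 hn2
    calc u < 2 ^ (n + 1) * 2 ^ j := this
      _ = 2 ^ (j + 1) * 2 ^ n := by ring
  have hw_pos : 0 < w := lt_of_lt_of_le h2j hw_lo
  set q : ℕ := ⌈w⌉₊ with hq_def
  have hq_ge : w ≤ (q : ℝ) := Nat.le_ceil w
  have hq_lt : (q : ℝ) < w + 1 := Nat.ceil_lt_add_one hw_pos.le
  have hq1 : 1 ≤ q := Nat.one_le_iff_ne_zero.2 (Nat.pos_iff_ne_zero.1 (Nat.ceil_pos.2 hw_pos))
  have hq_le : q ≤ 2 ^ (j + 1) := by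
    rw [hq_def, Nat.ceil_le]
    exact_mod_cast hw_hi.le
  have hq_pos : (0 : ℝ) < q := by exact_mod_cast hq1
  -- the orbit mesh δ'' := δ₀ / (q 2^n) lies in [δ/ρ, δ]
  set δ'' : ℝ := δ₀ / ((q : ℝ) * 2 ^ n) with hδ''_def
  have hqn_pos : (0 : ℝ) < (q : ℝ) * 2 ^ n := by positivity
  have hδ''_pos : 0 < δ'' := div_pos hδ₀ hqn_pos
  have hu_eq : w * 2 ^ n = u := by
    rw [hw_def]; field_simp
  have hδ_eq : δ = δ₀ / u := by
    rw [hu_def]; field_simp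
  have hA : δ'' ≤ δ := by
    rw [hδ_eq, hδ''_def]
    apply div_le_div_of_nonneg_left hδ₀.le hu_pos
    calc u = w * 2 ^ n := hu_eq.symm
      _ ≤ (q : ℝ) * 2 ^ n := by gcongr
  have hB : δ ≤ ρ * δ'' := by
    -- q 2^n < (w + 1) 2^n = u + 2^n ≤ u + u / 2^j < u + (ρ - 1) u = ρ u
    have h1 : (q : ℝ) * 2 ^ n < u + 2 ^ n := by
      calc (q : ℝ) * 2 ^ n < (w + 1) * 2 ^ n := by gcongr
        _ = u + 2 ^ n := by rw [add_mul, hu_eq, one_mul]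
    have h2 : (2 : ℝ) ^ n ≤ u / 2 ^ j := hn1
    have h3 : u / 2 ^ j < (ρ - 1) * u := by
      rw [div_lt_iff₀ h2j]
      have := (div_lt_iff₀ h2j).1 hj'
      nlinarith [this, hu_pos]
    have h4 : (q : ℝ) * 2 ^ n < ρ * u := by linarith
    rw [hδ_eq, hδ''_def, div_le_iff₀ hu_pos]
    have h5 : ρ * (δ₀ / ((q : ℝ) * 2 ^ n)) * u = δ₀ * (ρ * u) / ((q : ℝ) * 2 ^ n) := by ring
    rw [h5, le_div_iff₀ hqn_pos]
    exact mul_le_mul_of_nonneg_left h4.le hδ₀.le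
  -- (5) conclude: |P δ - L| ≤ |P δ - P δ''| + |P δ'' - L| < ε/2 + ε/2
  have hcmp : |P δ - P δ''| ≤ ε / 2 := hC δ'' δ hδ''_pos hA hB hδ₁'
  have htail : |P δ'' - L| < ε / 2 := hK q hq1 n ((hKle q hq_le).trans hKn)
  rw [Real.dist_eq]
  calc |P δ - L| ≤ |P δ - P δ''| + |P δ'' - L| := abs_sub_le _ _ _
    _ < ε / 2 + ε / 2 := add_lt_add_of_le_of_lt hcmp htail
    _ = ε := add_halves ε

/-- **Reduction of the crux to its dyadic cores** (registered stub `stub_reductionToDyadic` of the line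
`registered`): dyadic LimitExists for all polyomino representations with lattice marks, plus the
identification of every dyadic orbit limit as `I_a(cross-ratio)` for ONE `a ∈ (0,1)`, imply
`CardyTensorRG.PolyominoGaussianLaw`. Proof: refinement (`stub_polyominoRefinement`) gives the limits
`I_a(η)` along all blocking orbits `δ₀/(q·2^k)`; mesh equicontinuity (`stub_meshEquicontinuity`) and the
net lemma `tendsto_nhdsWithin_zero_of_orbits` upgrade them to the one-sided limit `δ → 0⁺`. [folklore] -/
theorem stub_reductionToDyadic :
    (∀ R : Literature.Probability.RandomPlanarGeometry.ConformalRectangle, ∀ δ₀ : ℝ, 0 < δ₀ →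
      (∃ s : Finset (ℤ × ℤ), R.carrier = interior (⋃ p ∈ s, {z : ℂ | δ₀ * (p.1 : ℝ) ≤ z.re ∧
        z.re ≤ δ₀ * ((p.1 : ℝ) + 1) ∧ δ₀ * (p.2 : ℝ) ≤ z.im ∧ z.im ≤ δ₀ * ((p.2 : ℝ) + 1)})) →
      (∀ i, ∃ m n : ℤ, R.pt i = (δ₀ : ℂ) * ((m : ℂ) + (n : ℂ) * Complex.I)) →
      ∃ L : ℝ, Filter.Tendsto
        (fun k : ℕ => Literature.Probability.Percolation.bondDomainCrossingProb R (δ₀ / 2 ^ k))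
        Filter.atTop (nhds L)) →
    (∃ a : ℝ, a ∈ Set.Ioo (0 : ℝ) 1 ∧
      ∀ R : Literature.Probability.RandomPlanarGeometry.ConformalRectangle, ∀ δ₀ : ℝ, 0 < δ₀ →
      (∃ s : Finset (ℤ × ℤ), R.carrier = interior (⋃ p ∈ s, {z : ℂ | δ₀ * (p.1 : ℝ) ≤ z.re ∧
        z.re ≤ δ₀ * ((p.1 : ℝ) + 1) ∧ δ₀ * (p.2 : ℝ) ≤ z.im ∧ z.im ≤ δ₀ * ((p.2 : ℝ) + 1)})) →
      (∀ i, ∃ m n : ℤ, R.pt i = (δ₀ : ℂ) * ((m : ℂ) + (n : ℂ) * Complex.I)) →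
      ∀ (φ : Literature.Probability.RandomPlanarGeometry.ConformalEquiv UpperHalfPlane.upperHalfPlaneSet R.carrier)
        (x : Fin 4 → ℝ), R.IsUniformizing φ x →
      ∀ L : ℝ, Filter.Tendsto
        (fun k : ℕ => Literature.Probability.Percolation.bondDomainCrossingProb R (δ₀ / 2 ^ k))
        Filter.atTop (nhds L) →
        L = intervalIntegral (fun s : ℝ => (s * (1 - s)) ^ (-a)) 0
              (Literature.Probability.RandomPlanarGeometry.crossRatio x) MeasureTheory.volume /
            intervalIntegral (fun s : ℝ => (s * (1 - s)) ^ (-a)) 0 1 MeasureTheory.volume) →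
      Summit.CriticalPhenomena.CardyFormulaZ2.Theses.CardyTensorRG.PolyominoGaussianLaw := by
  intro hE hI
  obtain ⟨a, ha, hIa⟩ := hI
  refine ⟨a, ha, ?_⟩
  intro R hR φ x hφ
  obtain ⟨δ₀, hδ₀, hs, hmarks⟩ := hR
  have horbit : ∀ q : ℕ, 1 ≤ q → Tendsto
      (fun k : ℕ => Literature.Probability.Percolation.bondDomainCrossingProb R (δ₀ / ((q : ℝ) * 2 ^ k)))
      atTop (𝓝 (intervalIntegral (fun s : ℝ => (s * (1 - s)) ^ (-a)) 0
              (Literature.Probability.RandomPlanarGeometry.crossRatio x) MeasureTheory.volume /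
            intervalIntegral (fun s : ℝ => (s * (1 - s)) ^ (-a)) 0 1 MeasureTheory.volume)) := by
    intro q hq
    have hq0 : (0 : ℝ) < q := by exact_mod_cast hq
    obtain ⟨hs', hmarks'⟩ := stub_polyominoRefinement R δ₀ hδ₀ hs hmarks q hq
    obtain ⟨L, hL⟩ := hE R (δ₀ / (q : ℝ)) (div_pos hδ₀ hq0) hs' hmarks'
    have hLeq := hIa R (δ₀ / (q : ℝ)) (div_pos hδ₀ hq0) hs' hmarks' φ x hφ L hL
    rw [hLeq] at hL
    have heq : (fun k : ℕ => Literature.Probability.Percolation.bondDomainCrossingProb R (δ₀ / ((q : ℝ) * 2 ^ k))) =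
        fun k : ℕ => Literature.Probability.Percolation.bondDomainCrossingProb R (δ₀ / (q : ℝ) / 2 ^ k) := by
      funext k
      rw [div_div]
    rw [heq]
    exact hL
  exact tendsto_nhdsWithin_zero_of_orbits hδ₀ horbit (stub_meshEquicontinuity R ⟨δ₀, hδ₀, hs, hmarks⟩)

end Summit.CriticalPhenomena.CardyFormulaZ2.Cruxes.PolyominoGaussianLaw.Birth
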